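import Summits.QuantumFields.YangMills.Theorems.InfiniteVolumeNontrivialOn
import Summits.QuantumFields.YangMills.Theorems.InfiniteVolumeContinuumDataOn
import Summits.QuantumFields.YangMills.Theorems.BalabanLadderInfVolFloorsCore
import Summits.QuantumFields.YangMills.Theorems.InfiniteVolumeMomentBounds
import Summits.QuantumFields.YangMills.Theorems.BalabanLadderROTClassDefs
import HarnessLib

/-!
# Infinite volume by compactness, class-parametric form III-b: the «`L → ∞` first» continuum data WITH
# non-triviality and non-Gaussianity — for ANY state family with floors and ceilings, and ALONG A TORUS CLASS

HONEST FRAMING (cell `ym-fleet`, seat `ym-infvol-p2`, director-ym R136 (i); count-neutral helper for route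
`InfiniteVolumeContinuum`, target stmt-QuantumFields-19927, and for the route owner's R85 §5b options (ii)∕(iv):
under the spine's `ROT` rev 2′ the rotation leg is CLASS-LOCAL — `∃ S, UnboundedClass S ∧ LatticeRotWardOn G r a S` —
so the route's DATA must be read on infinite-volume states chosen ALONG odd tori whose half-sides lie in `S`; this is
the one piece the located memo `pub/ym-fleet/ym-infvol-p1/R85-ROT-IMPACT-infvol.md` §3 (ii) lists as missing: «NT∕NG
along states chosen in a class»).  Pure soft analysis, kernel-checked.  The floors (`LowerBoundsOn G r a 𝓢`, resp. the
spine currency `LowerBounds G r a`) and the ceilings (`MomentBounds6On G r a 𝓢`, resp. `MomentBounds6 G r a`) are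
HYPOTHESES (owed by the spine's cruxes `NT` 19353 ∕ `UVSeamRec` 20043); the ROUTE is conditional on Track A's UV Prop
`BalabanLadder.UV`; existence half only; NOTHING is asserted about Bałaban's renormalisation group, uniqueness of the
infinite-volume state, rotations (E1), a mass gap, or Clay.

WHAT IS PROVED ([folklore] throughout).
* §4 **`exists_ivDataOn_nt_ng_of_states`** — the seat's `exists_ivDataOn_of_states` (DATA + E0 + E0′ + E3 +
  translations + Schwartz bounds, Theorems/InfiniteVolumeContinuumDataOn.lean) COMPLETED by NT ∕ NG
  (`twoPointNontrivial_of_data_on`, `nonGaussian_of_data_on`, Theorems/InfiniteVolumeNontrivialOn.lean): for given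
  couplings `β_k → ∞` and states `μ_k ∈ 𝓢 (β_k)` of a family with `MomentBounds6On`, `LowerBoundsOn`,
  `𝓢 ⊆ infiniteVolumeLimitPoints` — every clause of the route's support `IVData` with the states ranging over `𝓢`
  (class-parametric: no parity, no oddness used).
* §5 **`exists_ivDataOn_nt_ng_along`** — THE ALONG-A-CLASS INSTANCE in the spine's currency: `a > 0`, `a → 0`,
  `LowerBounds G r a`, `MomentBounds6 G r a`, and an unbounded class `S` of half-sides (`ROT.UnboundedClass S`) give
  couplings `β_k → ∞`, ONE strictly increasing `N` with every `N j ∈ S`, infinite-volume states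
  `IsInfiniteVolumeLimitAlong r.ρ (β k) (fun j => 2 * N j) (μ k)` (limits ALONG the odd tori `(ℤ/(2N_j+1))⁴` of the
  class), and `(S₁, T)` with the DATA clause, E0, E0′, E3, translations, NT, NG and the Schwartz bounds — the binders of
  p1's class-local E1 theorem `E1.isEuclideanInvariant_of_latticeRotWardOn` (with `N k := N`) and, via
  `mem_oddTorusLimitPoints_of_along`, of p3's `IVReflectionPositivity`.

References: K. Osterwalder, E. Seiler, Ann. Phys. 110 (1978) §2; S. Chatterjee, arXiv:1803.01950 §2; A. Jaffe,
E. Witten (2006) §5–§6; J. Glimm, A. Jaffe, Quantum Physics (1987) §6.1.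
-/

set_option autoImplicit false

noncomputable section

open scoped BigOperators SchwartzMap
open MeasureTheory Filter Topology
open Literature.MathematicalPhysics.QuantumFieldTheory hiding ZdEdge
open Literature.MathematicalPhysics.QuantumLattice
open Literature.MathematicalPhysics.AQFT
open Literature.Probability.LatticeModels (Site)
open Summit.QuantumFields.YangMills.Cruxes.OSLegsFromFemtoAndGap.DlrCollarTransfer (MomentBounds6 LowerBounds)
open Summit.QuantumFields.YangMills.Theorems.ROT (UnboundedClass)

namespace Summit.QuantumFields.YangMills.Theorems.InfiniteVolume

variable {G : Type} [Group G] [TopologicalSpace G] [IsTopologicalGroup G] [CompactSpace G]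
  [MeasurableSpace G] [BorelSpace G]

/-! ## §4 The full package for GIVEN couplings and states of a family with floors and ceilings -/

/-- **The «`L → ∞` first» one-field data WITH non-triviality and non-Gaussianity, for given states of a family with
volume-free floors and ceilings.**  `a > 0`, `a → 0`, `MomentBounds6On G r a 𝓢`, `LowerBoundsOn G r a 𝓢`,
`𝓢 β ⊆ infiniteVolumeLimitPoints r.ρ β`; couplings `β_k → ∞`, states `μ_k ∈ 𝓢 (β_k)`.  Then along a strictly
increasing `φ` there are `(S₁, T)` with: the conventions (`S₁ 0` = evaluation, `S₁ 1 = 0`, `S₁ n = Σ_{q valid} T n q`),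
the DATA-clause convergence (plaquette-CENTRE smearing) along `φ`, E0, E0′ (linear growth), E3, translation invariance
on `⁰𝒮`, the NT and NG clauses of the route's leaf VERBATIM, and the Schwartz bounds — i.e. the conclusion of the
route's support `IVData` with `oddTorusLimitPoints` replaced by the family `𝓢` (no parity used anywhere). [folklore] -/
theorem exists_ivDataOn_nt_ng_of_states (r : LatticeRep G) {a : ℝ → ℝ} (hapos : ∀ β, 0 < a β)
    (ha0 : Tendsto a atTop (𝓝 0)) {𝓢 : ℝ → Set (Measure (LGConfig 4 G))} (hMB : MomentBounds6On G r a 𝓢)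
    (hLB : LowerBoundsOn G r a 𝓢) (h𝓢 : ∀ β, 𝓢 β ⊆ infiniteVolumeLimitPoints (d := 4) r.ρ β)
    (β : ℕ → ℝ) (hβ : Tendsto β atTop atTop) (μ : ℕ → Measure (LGConfig 4 G)) (hμ : ∀ k, μ k ∈ 𝓢 (β k)) :
    ∃ (φ : ℕ → ℕ), StrictMono φ ∧ ∃ (S₁ : SchwingerFamily (EuclideanSpace ℝ (Fin 4)))
      (T : (n : ℕ) → (Fin n → Fin 4 × Fin 4) → (𝓢((Fin n → EuclideanSpace ℝ (Fin 4)), ℂ) →L[ℂ] ℂ)),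
      (∀ F : 𝓢((Fin 0 → EuclideanSpace ℝ (Fin 4)), ℂ), S₁ 0 F = F default) ∧
      (∀ F : 𝓢((Fin 1 → EuclideanSpace ℝ (Fin 4)), ℂ), S₁ 1 F = 0) ∧
      (∀ n : ℕ, 2 ≤ n → ∀ F : 𝓢((Fin n → EuclideanSpace ℝ (Fin 4)), ℂ),
        S₁ n F = ∑ q ∈ Fintype.piFinset (fun _ : Fin n => Finset.univ.filter fun p : Fin 4 × Fin 4 => p.1 < p.2),
          T n q F) ∧
      (∀ n : ℕ, 2 ≤ n → ∀ q : Fin n → Fin 4 × Fin 4, (∀ i, (q i).1 < (q i).2) →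
        ∀ F : 𝓢((Fin n → EuclideanSpace ℝ (Fin 4)), ℂ), IsOffDiagonal F →
          Tendsto (fun k => ∑' x : Fin n → Site 4, ((stateMomentStr G r (μ (φ k)) n q x : ℝ) : ℂ) *
            F (fun l => a (β (φ k)) • siteToE (x l) +
              (a (β (φ k)) / 2) • (EuclideanSpace.single (q l).1 (1 : ℝ) + EuclideanSpace.single (q l).2 (1 : ℝ))))
            atTop (𝓝 (T n q F))) ∧
      S₁.toLabelled.IsNormalized ∧ S₁.toLabelled.HasLinearGrowth ∧ S₁.toLabelled.IsSymmetric ∧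
      (∀ (n : ℕ) (t : EuclideanSpace ℝ (Fin 4)) (F : 𝓢((Fin n → EuclideanSpace ℝ (Fin 4)), ℂ)), IsOffDiagonal F →
        S₁ n (translateMulti t F) = S₁ n F) ∧
      (∃ (F₁ G₁ : 𝓢((Fin 1 → EuclideanSpace ℝ (Fin 4)), ℂ)) (H₁ : 𝓢((Fin (1 + 1) → EuclideanSpace ℝ (Fin 4)), ℂ)),
        IsTimeOrdered F₁ ∧ IsTimeOrdered G₁ ∧ IsAppendTensorOf H₁ (osAdjoint F₁) G₁ ∧
          S₁.toLabelled (1 + 1) (fun _ => ()) H₁ ≠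
            S₁.toLabelled 1 (fun _ => ()) (osAdjoint F₁) * S₁.toLabelled 1 (fun _ => ()) G₁) ∧
      (∃ (f g h : 𝓢(EuclideanSpace ℝ (Fin 4), ℂ)) (Ffgh : 𝓢((Fin 3 → EuclideanSpace ℝ (Fin 4)), ℂ))
        (Fgh Ffh Ffg : 𝓢((Fin 2 → EuclideanSpace ℝ (Fin 4)), ℂ))
        (Ff Fg Fh : 𝓢((Fin 1 → EuclideanSpace ℝ (Fin 4)), ℂ)),
        IsTensorOf Ffgh ![f, g, h] ∧ IsOffDiagonal Ffgh ∧ IsTensorOf Fgh ![g, h] ∧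
        IsTensorOf Ffh ![f, h] ∧ IsTensorOf Ffg ![f, g] ∧ IsTensorOf Ff ![f] ∧ IsTensorOf Fg ![g] ∧
        IsTensorOf Fh ![h] ∧
          S₁.toLabelled 3 (fun _ => ()) Ffgh - S₁.toLabelled 1 (fun _ => ()) Ff * S₁.toLabelled 2 (fun _ => ()) Fgh -
            S₁.toLabelled 1 (fun _ => ()) Fg * S₁.toLabelled 2 (fun _ => ()) Ffh -
            S₁.toLabelled 1 (fun _ => ()) Fh * S₁.toLabelled 2 (fun _ => ()) Ffg +
            2 * (S₁.toLabelled 1 (fun _ => ()) Ff * S₁.toLabelled 1 (fun _ => ()) Fg *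
              S₁.toLabelled 1 (fun _ => ()) Fh) ≠ 0) ∧
      (∃ K : ℝ, 0 ≤ K ∧ (∀ n q F, ‖T n q F‖ ≤ 5 * K ^ n * schwartzNorm (10 * n) F) ∧
        ∀ n F, ‖S₁ n F‖ ≤ 5 * (6 * K) ^ n * schwartzNorm (10 * n) F) := by
  obtain ⟨φ, hφ, S₁, T, h0, h1, h2, hconv, hN, hLG, hE3, htr, hbds⟩ :=
    exists_ivDataOn_of_states r hapos ha0 hMB h𝓢 β hβ μ hμ
  have hβφ : Tendsto (fun k => β (φ k)) atTop atTop := hβ.comp hφ.tendsto_atTop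
  have hμφ : ∀ k, μ (φ k) ∈ 𝓢 (β (φ k)) := fun k => hμ (φ k)
  exact ⟨φ, hφ, S₁, T, h0, h1, h2, hconv, hN, hLG, hE3, htr,
    twoPointNontrivial_of_data_on r hapos ha0 hMB hLB h𝓢 (fun k => β (φ k)) hβφ (fun k => μ (φ k)) hμφ S₁ T h1 h2
      hconv,
    nonGaussian_of_data_on r hapos ha0 hMB hLB h𝓢 (fun k => β (φ k)) hβφ (fun k => μ (φ k)) hμφ S₁ T h1 h2 hconv,
    hbds⟩

/-! ## §5 The instance ALONG A TORUS CLASS, in the spine's currency -/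

/-- A state that is an infinite-volume limit along odd tori `(ℤ/(2N_j+1))⁴`, `N` strictly increasing, is an odd-torus
limit point. [folklore] -/
theorem mem_oddTorusLimitPoints_of_along (r : LatticeRep G) {β : ℝ} {N : ℕ → ℕ} (hN : StrictMono N)
    {μ : Measure (LGConfig 4 G)} (hμ : IsInfiniteVolumeLimitAlong (d := 4) r.ρ β (fun j => 2 * N j) μ) :
    μ ∈ oddTorusLimitPoints r β :=
  ⟨N, hN, hμ⟩

/-- **For an unbounded class of half-sides there are ONE strictly increasing `N` in the class and, at every coupling,
an infinite-volume state along the odd tori `(ℤ/(2N_j+1))⁴`** (enumerate `S` increasingly, then the joint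
thermodynamic subsequence `exists_strictMono_forall_limitAlong_sides`). [folklore] -/
theorem exists_strictMono_mem_forall_limitAlong_odd (r : LatticeRep G) (β : ℕ → ℝ) {S : Set ℕ}
    (hS : UnboundedClass S) :
    ∃ N : ℕ → ℕ, StrictMono N ∧ (∀ j, N j ∈ S) ∧ ∃ μ : ℕ → Measure (LGConfig 4 G),
      ∀ k, IsProbabilityMeasure (μ k) ∧ IsInfiniteVolumeLimitAlong (d := 4) r.ρ (β k) (fun j => 2 * N j) (μ k) := by
  have hSinf : S.Infinite := by
    refine Set.infinite_of_forall_exists_gt fun m => ?_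
    obtain ⟨L, hL, hmL⟩ := hS (m + 1)
    exact ⟨L, hL, by omega⟩
  have hEmono : StrictMono (Nat.nth (· ∈ S)) := Nat.nth_strictMono hSinf
  have hEmem : ∀ n, Nat.nth (· ∈ S) n ∈ S := fun n => Nat.nth_mem_of_infinite hSinf n
  obtain ⟨φ, hφ, μ, hμ⟩ := exists_strictMono_forall_limitAlong_sides r β (fun n => 2 * Nat.nth (· ∈ S) n)
  exact ⟨fun j => Nat.nth (· ∈ S) (φ j), hEmono.comp hφ, fun j => hEmem (φ j), μ, hμ⟩

/-- **THE «`L → ∞` first» ONE-FIELD DATA WITH NT ∕ NG, READ ALONG A TORUS CLASS.**  `a > 0`, `a → 0`, the spine's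
floors `LowerBounds G r a` and ceilings `MomentBounds6 G r a`, and an unbounded class `S` of half-sides
(`ROT.UnboundedClass S`, the class the spine's rotation leg rev 2′ produces): then there are couplings `β_k → ∞`, ONE
strictly increasing `N` with every `N j ∈ S`, infinite-volume states `μ_k` that are limits ALONG the odd tori
`(ℤ/(2N_j+1))⁴` of the class (`IsInfiniteVolumeLimitAlong r.ρ (β k) (fun j => 2 * N j) (μ k)`), and `(S₁, T)` with the
conventions, the DATA-clause convergence (plaquette-CENTRE smearing), E0, E0′, E3, translation invariance on `⁰𝒮`, the
NT and NG clauses VERBATIM, and the Schwartz bounds.  These are the binders of p1's class-local E1 theorem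
`E1.isEuclideanInvariant_of_latticeRotWardOn` (take `N k := N`) and, via `mem_oddTorusLimitPoints_of_along`, of p3's
`IVReflectionPositivity`.  Mechanism: §4 for the family
`𝓢_S β = {μ | ∃ N, StrictMono N ∧ (∀ j, N j ∈ S) ∧ IsInfiniteVolumeLimitAlong r.ρ β (2N) μ} ⊆ oddTorusLimitPoints r β`
(ceilings `momentBounds6_infiniteVolume`, floors `lowerBounds_oddTorusLimitPoints`, both antitone in the family) and
the states of `exists_strictMono_mem_forall_limitAlong_odd`. [folklore] -/
theorem exists_ivDataOn_nt_ng_along (r : LatticeRep G) {a : ℝ → ℝ} (hapos : ∀ β, 0 < a β)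
    (ha0 : Tendsto a atTop (𝓝 0)) (hLB : LowerBounds G r a) (hMB : MomentBounds6 G r a) {S : Set ℕ}
    (hS : UnboundedClass S) :
    ∃ (β : ℕ → ℝ) (N : ℕ → ℕ) (μ : ℕ → Measure (LGConfig 4 G)) (S₁ : SchwingerFamily (EuclideanSpace ℝ (Fin 4)))
      (T : (n : ℕ) → (Fin n → Fin 4 × Fin 4) → (𝓢((Fin n → EuclideanSpace ℝ (Fin 4)), ℂ) →L[ℂ] ℂ)),
      Tendsto β atTop atTop ∧ StrictMono N ∧ (∀ j, N j ∈ S) ∧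
      (∀ k, IsInfiniteVolumeLimitAlong (d := 4) r.ρ (β k) (fun j => 2 * N j) (μ k)) ∧
      (∀ F : 𝓢((Fin 0 → EuclideanSpace ℝ (Fin 4)), ℂ), S₁ 0 F = F default) ∧
      (∀ F : 𝓢((Fin 1 → EuclideanSpace ℝ (Fin 4)), ℂ), S₁ 1 F = 0) ∧
      (∀ n : ℕ, 2 ≤ n → ∀ F : 𝓢((Fin n → EuclideanSpace ℝ (Fin 4)), ℂ),
        S₁ n F = ∑ q ∈ Fintype.piFinset (fun _ : Fin n => Finset.univ.filter fun p : Fin 4 × Fin 4 => p.1 < p.2),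
          T n q F) ∧
      (∀ n : ℕ, 2 ≤ n → ∀ q : Fin n → Fin 4 × Fin 4, (∀ i, (q i).1 < (q i).2) →
        ∀ F : 𝓢((Fin n → EuclideanSpace ℝ (Fin 4)), ℂ), IsOffDiagonal F →
          Tendsto (fun k => ∑' x : Fin n → Site 4, ((stateMomentStr G r (μ k) n q x : ℝ) : ℂ) *
            F (fun l => a (β k) • siteToE (x l) +
              (a (β k) / 2) • (EuclideanSpace.single (q l).1 (1 : ℝ) + EuclideanSpace.single (q l).2 (1 : ℝ))))
            atTop (𝓝 (T n q F))) ∧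
      S₁.toLabelled.IsNormalized ∧ S₁.toLabelled.HasLinearGrowth ∧ S₁.toLabelled.IsSymmetric ∧
      (∀ (n : ℕ) (t : EuclideanSpace ℝ (Fin 4)) (F : 𝓢((Fin n → EuclideanSpace ℝ (Fin 4)), ℂ)), IsOffDiagonal F →
        S₁ n (translateMulti t F) = S₁ n F) ∧
      (∃ (F₁ G₁ : 𝓢((Fin 1 → EuclideanSpace ℝ (Fin 4)), ℂ)) (H₁ : 𝓢((Fin (1 + 1) → EuclideanSpace ℝ (Fin 4)), ℂ)),
        IsTimeOrdered F₁ ∧ IsTimeOrdered G₁ ∧ IsAppendTensorOf H₁ (osAdjoint F₁) G₁ ∧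
          S₁.toLabelled (1 + 1) (fun _ => ()) H₁ ≠
            S₁.toLabelled 1 (fun _ => ()) (osAdjoint F₁) * S₁.toLabelled 1 (fun _ => ()) G₁) ∧
      (∃ (f g h : 𝓢(EuclideanSpace ℝ (Fin 4), ℂ)) (Ffgh : 𝓢((Fin 3 → EuclideanSpace ℝ (Fin 4)), ℂ))
        (Fgh Ffh Ffg : 𝓢((Fin 2 → EuclideanSpace ℝ (Fin 4)), ℂ))
        (Ff Fg Fh : 𝓢((Fin 1 → EuclideanSpace ℝ (Fin 4)), ℂ)),
        IsTensorOf Ffgh ![f, g, h] ∧ IsOffDiagonal Ffgh ∧ IsTensorOf Fgh ![g, h] ∧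
        IsTensorOf Ffh ![f, h] ∧ IsTensorOf Ffg ![f, g] ∧ IsTensorOf Ff ![f] ∧ IsTensorOf Fg ![g] ∧
        IsTensorOf Fh ![h] ∧
          S₁.toLabelled 3 (fun _ => ()) Ffgh - S₁.toLabelled 1 (fun _ => ()) Ff * S₁.toLabelled 2 (fun _ => ()) Fgh -
            S₁.toLabelled 1 (fun _ => ()) Fg * S₁.toLabelled 2 (fun _ => ()) Ffh -
            S₁.toLabelled 1 (fun _ => ()) Fh * S₁.toLabelled 2 (fun _ => ()) Ffg +
            2 * (S₁.toLabelled 1 (fun _ => ()) Ff * S₁.toLabelled 1 (fun _ => ()) Fg *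
              S₁.toLabelled 1 (fun _ => ()) Fh) ≠ 0) ∧
      (∃ K : ℝ, 0 ≤ K ∧ (∀ n q F, ‖T n q F‖ ≤ 5 * K ^ n * schwartzNorm (10 * n) F) ∧
        ∀ n F, ‖S₁ n F‖ ≤ 5 * (6 * K) ^ n * schwartzNorm (10 * n) F) := by
  -- the state family of limits along odd tori of the class
  set 𝓢 : ℝ → Set (Measure (LGConfig 4 G)) := fun b => {ν | ∃ N : ℕ → ℕ, StrictMono N ∧ (∀ j, N j ∈ S) ∧
    IsInfiniteVolumeLimitAlong (d := 4) r.ρ b (fun j => 2 * N j) ν} with h𝓢def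
  have h𝓢odd : ∀ b, 𝓢 b ⊆ oddTorusLimitPoints r b := fun b ν hν => by
    obtain ⟨N, hN, -, hlim⟩ := hν
    exact ⟨N, hN, hlim⟩
  have h𝓢 : ∀ b, 𝓢 b ⊆ infiniteVolumeLimitPoints (d := 4) r.ρ b := fun b ν hν => by
    obtain ⟨N, hN, -, hlim⟩ := hν
    exact ⟨fun k => 2 * N k, fun i j hij => Nat.mul_lt_mul_of_pos_left (hN hij) two_pos, hlim⟩
  -- ceilings and floors pass to the odd-torus limit states (same constants), hence to the sub-family `𝓢`
  have hMBOn : MomentBounds6On G r a 𝓢 := by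
    obtain ⟨C, β₄, ℓ₄, hℓ, hC, H⟩ := (momentBounds6_infiniteVolume r hMB : MomentBounds6On G r a (oddTorusLimitPoints r))
    exact ⟨C, β₄, ℓ₄, hℓ, hC, fun b hb ν hν => H b hb ν (h𝓢odd b hν)⟩
  have hLBOn : LowerBoundsOn G r a 𝓢 := by
    obtain ⟨⟨v, ε, β₅, hv, hε, H2⟩, ⟨f, g, k, ε', β₆, hfg, hgk, hfk, hε', H3⟩⟩ :=
      (lowerBounds_oddTorusLimitPoints r hapos hLB : LowerBoundsOn G r a (oddTorusLimitPoints r))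
    exact ⟨⟨v, ε, β₅, hv, hε, fun b hb ν hν => H2 b hb ν (h𝓢odd b hν)⟩,
      ⟨f, g, k, ε', β₆, hfg, hgk, hfk, hε', fun b hb ν hν => H3 b hb ν (h𝓢odd b hν)⟩⟩
  -- couplings `β k = k`, states along one side sequence in the class
  obtain ⟨N, hN, hNS, μ, hμ⟩ := exists_strictMono_mem_forall_limitAlong_odd r (fun k => (k : ℝ)) hS
  have hμmem : ∀ k : ℕ, μ k ∈ 𝓢 ((k : ℕ) : ℝ) := fun k => ⟨N, hN, hNS, (hμ k).2⟩
  obtain ⟨φ, hφ, S₁, T, h0, h1, h2, hconv, hN', hLG, hE3, htr, hNT, hNG, hbds⟩ :=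
    exists_ivDataOn_nt_ng_of_states r hapos ha0 hMBOn hLBOn h𝓢 (fun k => (k : ℝ)) tendsto_natCast_atTop_atTop μ
      hμmem
  exact ⟨fun k => ((φ k : ℕ) : ℝ), N, fun k => μ (φ k), S₁, T, tendsto_natCast_atTop_atTop.comp hφ.tendsto_atTop,
    hN, hNS, fun k => (hμ (φ k)).2, h0, h1, h2, hconv, hN', hLG, hE3, htr, hNT, hNG, hbds⟩

end Summit.QuantumFields.YangMills.Theorems.InfiniteVolume

end
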